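import Mathlib
import HarnessLib
import Summits.Ventures.LatticeQCDFlow.Exactness.IMHReversibleFlowProposals

/-!
# LatticeQCDFlow / Exactness — CHOOSING BETWEEN A GLOBAL FLOW JUMP AND A LOCAL MOVE WITH A STATE-DEPENDENT PROBABILITY IS EXACT —
# PROVIDED THE CHOICE PROBABILITY ENTERS THE ACCEPTANCE RATIO (`p(y)/p(x)` for the jump, `(1 − p(y))/(1 − p(x))` for the local move)

HONEST FRAMING: exact (Metropolis-corrected) sampling algorithms for lattice gauge theory;
figures of merit are autocorrelation/cost numbers at stated couplings and volumes; no
continuum-physics claim.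

Venture `LatticeQCDFlow` (cell pub-lqcd), topic `Exactness`, FANOUT row 30 (lean-1 GEN-43, part II: MOVES IN FLOW SPACE; sequel of
`IMHReversibleFlowProposals` and `IMHReversibleFlowProposalsDefensive`, where the mixing weight was a constant `p`).  NEW WORK of the cell;
no definition is introduced, nothing is cited as a fact.  Tree inputs: `IMHKernel` (`imhAcceptE`, `ofReal_mul_imhAcceptE` — used for the
TILTED weights `p·w` and `(1 − p)·w`), `IMHReversibleFlowProposals.revProposal_flux_symm`.  Printed counterparts NAMED ONLY: state-dependent
mixing of MCMC kernels needs the selection probabilities in the Hastings ratio (Tierney 1998 §2; the "kernel selection" construction of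
Andrieu–Lee–Livingstone 2020, arXiv:2012.14881 §2.3).

## The sampler (general measurable `Ω`; flow law `q`; weight `w > 0`; `π = w·q`; `R` Markov and reversible for `q`; `p : Ω → (0, 1)` measurable)

From `x`: with probability `p(x)` attempt a GLOBAL flow jump `y ∼ q` and accept it with `min(1, p(y)w(y) / (p(x)w(x)))`; otherwise attempt
the LOCAL move `y ∼ R(x, ·)` and accept it with `min(1, (1 − p(y))w(y) / ((1 − p(x))w(x)))`; else stay.  (E.g. jump more often from light,
flow-like configurations and crawl near heavy ones.)  Def-free: ANY kernel `K` with
`K(x, B) = ∫_B p(x)·a_{pw}(x, y) q(dy) + ∫_B (1 − p(x))·a_{(1−p)w}(x, y) R(x, dy) + (1 − m(x))·1_B(x)` (hypothesis `hK`), where `a_v` is the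
Metropolis ratio for the weight `v`.

## Results [all ours]

* `choice_flux_global` ∕ `choice_flux_local`: `w(x)·p(x)·a_{pw}(x, y) = min(p(x)w(x), p(y)w(y))` and
  `w(x)(1 − p(x))·a_{(1−p)w}(x, y) = min((1 − p(x))w(x), (1 − p(y))w(y))` — each branch has a symmetric flux for ITS OWN tilted weight.
* `choice_setLIntegral`: the mass flow splits into the global flux (Tonelli-symmetric), the local flux (symmetric by `q`-reversibility of `R`,
  `revProposal_flux_symm` with the weight `(1 − p)w`) and a diagonal term; `choiceMass_le_one`, `choice_isMarkovKernel`.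
* **`stateDependentChoice_isReversible` ∕ `stateDependentChoice_invariant`**: EVERY such `K` is `π`-reversible and leaves `π = w·q` invariant.
  With the PLAIN ratios instead, the global branch's flux would be `p(x)·min(w x, w y)` — not symmetric unless `p` is constant: adapting the
  jump frequency to the configuration is exact only through the ratio (the constant case is `IMHReversibleFlowProposalsDefensive`).
-/

namespace Summit.Ventures.LatticeQCDFlow.Exactness

open MeasureTheory ProbabilityTheory
open scoped ENNReal

variable {Ω : Type*} [MeasurableSpace Ω] {q : Measure Ω} [IsProbabilityMeasure q] {w p : Ω → ℝ}

/-! ## §1 The two tilted fluxes -/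

omit [MeasurableSpace Ω] in
/-- The tilted weights are positive. [ours, bookkeeping] -/
theorem tilt_pos (hw0 : ∀ x, 0 < w x) (hp0 : ∀ x, 0 < p x) (hp1 : ∀ x, p x < 1) :
    (∀ x, 0 < p x * w x) ∧ ∀ x, 0 < (1 - p x) * w x :=
  ⟨fun x => mul_pos (hp0 x) (hw0 x), fun x => mul_pos (sub_pos.2 (hp1 x)) (hw0 x)⟩

omit [MeasurableSpace Ω] in
/-- **The global branch's flux**: `w(x)·(p(x)·a_{pw}(x, y)) = min(p(x)w(x), p(y)w(y))`. [ours] -/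
theorem choice_flux_global (hw0 : ∀ x, 0 < w x) (hp0 : ∀ x, 0 < p x) (x y : Ω) :
    ENNReal.ofReal (w x) * (ENNReal.ofReal (p x) * imhAcceptE (fun z => p z * w z) x y) =
      ENNReal.ofReal (min (p x * w x) (p y * w y)) := by
  rw [← mul_assoc, ← ENNReal.ofReal_mul (hw0 x).le, mul_comm (w x),
    ofReal_mul_imhAcceptE (w := fun z => p z * w z) (fun z => mul_pos (hp0 z) (hw0 z))]

omit [MeasurableSpace Ω] in
/-- **The local branch's flux**: `w(x)·((1 − p(x))·a_{(1−p)w}(x, y)) = min((1 − p(x))w(x), (1 − p(y))w(y))`. [ours] -/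
theorem choice_flux_local (hw0 : ∀ x, 0 < w x) (hp1 : ∀ x, p x < 1) (x y : Ω) :
    ENNReal.ofReal (w x) * (ENNReal.ofReal (1 - p x) * imhAcceptE (fun z => (1 - p z) * w z) x y) =
      ENNReal.ofReal (min ((1 - p x) * w x) ((1 - p y) * w y)) := by
  rw [← mul_assoc, ← ENNReal.ofReal_mul (hw0 x).le, mul_comm (w x),
    ofReal_mul_imhAcceptE (w := fun z => (1 - p z) * w z) (fun z => mul_pos (sub_pos.2 (hp1 z)) (hw0 z))]

/-! ## §2 The kernel is Markov -/

/-- **THE MOVE MASS IS AT MOST ONE**: `p(x)·∫ a_{pw} dq + (1 − p(x))·∫ a_{(1−p)w} dR(x) ≤ p(x) + (1 − p(x)) = 1`. [ours] -/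
theorem choiceMass_le_one (hp0 : ∀ x, 0 < p x) (hp1 : ∀ x, p x < 1) (R : Kernel Ω Ω) [IsMarkovKernel R] (x : Ω) :
    ∫⁻ y, ENNReal.ofReal (p x) * imhAcceptE (fun z => p z * w z) x y ∂q +
        ∫⁻ y, ENNReal.ofReal (1 - p x) * imhAcceptE (fun z => (1 - p z) * w z) x y ∂(R x) ≤ 1 := by
  calc ∫⁻ y, ENNReal.ofReal (p x) * imhAcceptE (fun z => p z * w z) x y ∂q +
        ∫⁻ y, ENNReal.ofReal (1 - p x) * imhAcceptE (fun z => (1 - p z) * w z) x y ∂(R x)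
      ≤ ∫⁻ _, ENNReal.ofReal (p x) ∂q + ∫⁻ _, ENNReal.ofReal (1 - p x) ∂(R x) := by
        gcongr with y y
        · exact mul_le_of_le_one_right' (imhAcceptE_le_one _ x y)
        · exact mul_le_of_le_one_right' (imhAcceptE_le_one _ x y)
    _ = 1 := by
        rw [lintegral_const, lintegral_const, measure_univ, measure_univ, mul_one, mul_one,
          ← ENNReal.ofReal_add (hp0 x).le (sub_pos.2 (hp1 x)).le, add_sub_cancel, ENNReal.ofReal_one]

omit [IsProbabilityMeasure q] in
/-- `K(x, Ω) = 1`. [ours] -/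
theorem choice_apply_univ [IsProbabilityMeasure q] (hp0 : ∀ x, 0 < p x) (hp1 : ∀ x, p x < 1) (R : Kernel Ω Ω) [IsMarkovKernel R]
    (K : Kernel Ω Ω)
    (hK : ∀ (x : Ω) {B : Set Ω}, MeasurableSet B → K x B =
      ∫⁻ y in B, ENNReal.ofReal (p x) * imhAcceptE (fun z => p z * w z) x y ∂q +
        ∫⁻ y in B, ENNReal.ofReal (1 - p x) * imhAcceptE (fun z => (1 - p z) * w z) x y ∂(R x) +
        (1 - (∫⁻ y, ENNReal.ofReal (p x) * imhAcceptE (fun z => p z * w z) x y ∂q +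
          ∫⁻ y, ENNReal.ofReal (1 - p x) * imhAcceptE (fun z => (1 - p z) * w z) x y ∂(R x))) * B.indicator 1 x)
    (x : Ω) : K x Set.univ = 1 := by
  rw [hK x MeasurableSet.univ, Measure.restrict_univ, Measure.restrict_univ, Set.indicator_univ, Pi.one_apply, mul_one]
  exact add_tsub_cancel_of_le (choiceMass_le_one hp0 hp1 R x)

/-! ## §3 The mass flow and exactness -/

/-- **THE MASS-FLOW SPLIT**: global flux + local flux + diagonal. [ours] -/
theorem choice_setLIntegral (hw : Measurable w) (hp : Measurable p) (hw0 : ∀ x, 0 < w x) (hp0 : ∀ x, 0 < p x) (hp1 : ∀ x, p x < 1)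
    (R : Kernel Ω Ω) [IsMarkovKernel R] (K : Kernel Ω Ω)
    (hK : ∀ (x : Ω) {B : Set Ω}, MeasurableSet B → K x B =
      ∫⁻ y in B, ENNReal.ofReal (p x) * imhAcceptE (fun z => p z * w z) x y ∂q +
        ∫⁻ y in B, ENNReal.ofReal (1 - p x) * imhAcceptE (fun z => (1 - p z) * w z) x y ∂(R x) +
        (1 - (∫⁻ y, ENNReal.ofReal (p x) * imhAcceptE (fun z => p z * w z) x y ∂q +
          ∫⁻ y, ENNReal.ofReal (1 - p x) * imhAcceptE (fun z => (1 - p z) * w z) x y ∂(R x))) * B.indicator 1 x)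
    {A B : Set Ω} (hA : MeasurableSet A) (hB : MeasurableSet B) :
    ∫⁻ x in A, K x B ∂(q.withDensity fun x => ENNReal.ofReal (w x)) =
      (∫⁻ x in A, ∫⁻ y in B, ENNReal.ofReal (min (p x * w x) (p y * w y)) ∂q ∂q) +
      (∫⁻ x, ∫⁻ y, A.indicator (fun _ => (1 : ℝ≥0∞)) x *
        B.indicator (fun y => ENNReal.ofReal (min ((1 - p x) * w x) ((1 - p y) * w y))) y ∂(R x) ∂q) +
      ∫⁻ x in B ∩ A, ENNReal.ofReal (w x) * (1 - (∫⁻ y, ENNReal.ofReal (p x) * imhAcceptE (fun z => p z * w z) x y ∂q +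
          ∫⁻ y, ENNReal.ofReal (1 - p x) * imhAcceptE (fun z => (1 - p z) * w z) x y ∂(R x))) ∂q := by
  have hw₁ : Measurable fun z => p z * w z := hp.mul hw
  have hw₂ : Measurable fun z => (1 - p z) * w z := (measurable_const.sub hp).mul hw
  have hd : Measurable fun x => ENNReal.ofReal (w x) := hw.ennreal_ofReal
  have ha₁ : Measurable (Function.uncurry fun x y : Ω => ENNReal.ofReal (p x) * imhAcceptE (fun z => p z * w z) x y) :=
    (hp.ennreal_ofReal.comp measurable_fst).mul (measurable_imhAcceptE hw₁)
  have ha₂ : Measurable (Function.uncurry fun x y : Ω => ENNReal.ofReal (1 - p x) * imhAcceptE (fun z => (1 - p z) * w z) x y) :=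
    ((measurable_const.sub hp).ennreal_ofReal.comp measurable_fst).mul (measurable_imhAcceptE hw₂)
  have hI₁ : ∀ {C : Set Ω}, MeasurableSet C →
      Measurable fun x => ∫⁻ y in C, ENNReal.ofReal (p x) * imhAcceptE (fun z => p z * w z) x y ∂q := fun {C} hC => by
    have : Measurable fun x => ∫⁻ y, C.indicator (fun y => ENNReal.ofReal (p x) * imhAcceptE (fun z => p z * w z) x y) y ∂q :=
      (ha₁.indicator (measurable_snd hC) : Measurable fun r : Ω × Ω =>
        C.indicator (fun y => ENNReal.ofReal (p r.1) * imhAcceptE (fun z => p z * w z) r.1 y) r.2).lintegral_prod_right'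
    simpa only [lintegral_indicator hC] using this
  have hI₂ : ∀ {C : Set Ω}, MeasurableSet C →
      Measurable fun x => ∫⁻ y in C, ENNReal.ofReal (1 - p x) * imhAcceptE (fun z => (1 - p z) * w z) x y ∂(R x) := fun {C} hC => by
    have : Measurable fun x => ∫⁻ y, C.indicator (fun y => ENNReal.ofReal (1 - p x) * imhAcceptE (fun z => (1 - p z) * w z) x y) y ∂(R x) :=
      (ha₂.indicator (measurable_snd hC) : Measurable fun r : Ω × Ω =>
        C.indicator (fun y => ENNReal.ofReal (1 - p r.1) * imhAcceptE (fun z => (1 - p z) * w z) r.1 y) r.2).lintegral_kernel_prod_right'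
    simpa only [lintegral_indicator hC] using this
  have hmass : Measurable fun x => 1 - (∫⁻ y, ENNReal.ofReal (p x) * imhAcceptE (fun z => p z * w z) x y ∂q +
      ∫⁻ y, ENNReal.ofReal (1 - p x) * imhAcceptE (fun z => (1 - p z) * w z) x y ∂(R x)) := by
    have h1 := hI₁ MeasurableSet.univ
    have h2 := hI₂ MeasurableSet.univ
    simp only [Measure.restrict_univ] at h1 h2
    exact measurable_const.sub (h1.add h2)
  rw [setLIntegral_withDensity_eq_setLIntegral_mul _ hd (Kernel.measurable_coe K hB) hA]
  simp only [Pi.mul_apply]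
  have hpt : ∀ x, ENNReal.ofReal (w x) * K x B =
      ∫⁻ y in B, ENNReal.ofReal (min (p x * w x) (p y * w y)) ∂q +
        ENNReal.ofReal (w x) * ∫⁻ y in B, ENNReal.ofReal (1 - p x) * imhAcceptE (fun z => (1 - p z) * w z) x y ∂(R x) +
        B.indicator (fun x => ENNReal.ofReal (w x) * (1 - (∫⁻ y, ENNReal.ofReal (p x) * imhAcceptE (fun z => p z * w z) x y ∂q +
          ∫⁻ y, ENNReal.ofReal (1 - p x) * imhAcceptE (fun z => (1 - p z) * w z) x y ∂(R x)))) x := by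
    intro x
    rw [hK x hB, mul_add, mul_add, ← lintegral_const_mul _ (ha₁.of_uncurry_left)]
    congr 1
    · congr 1
      exact lintegral_congr fun y => choice_flux_global hw0 hp0 x y
    · by_cases hx : x ∈ B
      · rw [Set.indicator_of_mem hx, Set.indicator_of_mem hx, Pi.one_apply, mul_one]
      · rw [Set.indicator_of_notMem hx, Set.indicator_of_notMem hx, mul_zero, mul_zero]
  simp_rw [hpt]
  have hT1 : Measurable fun x => ∫⁻ y in B, ENNReal.ofReal (min (p x * w x) (p y * w y)) ∂q := by
    have hm : Measurable (Function.uncurry fun x y : Ω => ENNReal.ofReal (min (p x * w x) (p y * w y))) :=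
      ((hw₁.comp measurable_fst).min (hw₁.comp measurable_snd)).ennreal_ofReal
    have : Measurable fun x => ∫⁻ y, B.indicator (fun y => ENNReal.ofReal (min (p x * w x) (p y * w y))) y ∂q :=
      (hm.indicator (measurable_snd hB) : Measurable fun r : Ω × Ω =>
        B.indicator (fun y => ENNReal.ofReal (min (p r.1 * w r.1) (p y * w y))) r.2).lintegral_prod_right'
    simpa only [lintegral_indicator hB] using this
  have hT2 : Measurable fun x => ENNReal.ofReal (w x) *
      ∫⁻ y in B, ENNReal.ofReal (1 - p x) * imhAcceptE (fun z => (1 - p z) * w z) x y ∂(R x) := hd.mul (hI₂ hB)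
  have hind : Measurable (B.indicator fun x => ENNReal.ofReal (w x) * (1 - (∫⁻ y, ENNReal.ofReal (p x) *
      imhAcceptE (fun z => p z * w z) x y ∂q + ∫⁻ y, ENNReal.ofReal (1 - p x) * imhAcceptE (fun z => (1 - p z) * w z) x y ∂(R x)))) :=
    (show Measurable fun x => ENNReal.ofReal (w x) * (1 - (∫⁻ y, ENNReal.ofReal (p x) * imhAcceptE (fun z => p z * w z) x y ∂q +
      ∫⁻ y, ENNReal.ofReal (1 - p x) * imhAcceptE (fun z => (1 - p z) * w z) x y ∂(R x))) from hd.mul hmass).indicator hB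
  rw [lintegral_add_right _ hind, lintegral_add_left hT1, lintegral_indicator hB, Measure.restrict_restrict hB]
  congr 2
  -- the local branch as a double integral with indicators, flux form
  rw [← lintegral_indicator hA]
  refine lintegral_congr fun x => ?_
  by_cases hx : x ∈ A
  · simp only [Set.indicator_of_mem hx, one_mul]
    rw [← lintegral_indicator hB, ← lintegral_const_mul _ ((ha₂.of_uncurry_left).indicator hB)]
    refine lintegral_congr fun y => ?_
    by_cases hy : y ∈ B
    · rw [Set.indicator_of_mem hy, Set.indicator_of_mem hy, choice_flux_local hw0 hp1]
    · rw [Set.indicator_of_notMem hy, Set.indicator_of_notMem hy, mul_zero]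
  · simp only [Set.indicator_of_notMem hx, zero_mul, lintegral_zero]

/-- The global flux is symmetric (Tonelli). [ours, bookkeeping] -/
theorem choice_globalFlux_symm (hw : Measurable w) (hp : Measurable p) {A B : Set Ω} :
    ∫⁻ x in A, ∫⁻ y in B, ENNReal.ofReal (min (p x * w x) (p y * w y)) ∂q ∂q =
      ∫⁻ x in B, ∫⁻ y in A, ENNReal.ofReal (min (p x * w x) (p y * w y)) ∂q ∂q := by
  have hw₁ : Measurable fun z => p z * w z := hp.mul hw
  have hm : Measurable (Function.uncurry fun x y : Ω => ENNReal.ofReal (min (p x * w x) (p y * w y))) :=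
    ((hw₁.comp measurable_fst).min (hw₁.comp measurable_snd)).ennreal_ofReal
  rw [lintegral_lintegral_swap (hm.aemeasurable (μ := (q.restrict A).prod (q.restrict B)))]
  exact lintegral_congr fun y => lintegral_congr fun x => by rw [min_comm]

/-- **STATE-DEPENDENT CHOICE WITH THE CORRECTED RATIOS IS EXACT — DETAILED BALANCE.** [ours] -/
theorem stateDependentChoice_isReversible (hw : Measurable w) (hp : Measurable p) (hw0 : ∀ x, 0 < w x) (hp0 : ∀ x, 0 < p x)
    (hp1 : ∀ x, p x < 1) (R : Kernel Ω Ω) [IsMarkovKernel R] (hR : Kernel.IsReversible R q) (K : Kernel Ω Ω)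
    (hK : ∀ (x : Ω) {B : Set Ω}, MeasurableSet B → K x B =
      ∫⁻ y in B, ENNReal.ofReal (p x) * imhAcceptE (fun z => p z * w z) x y ∂q +
        ∫⁻ y in B, ENNReal.ofReal (1 - p x) * imhAcceptE (fun z => (1 - p z) * w z) x y ∂(R x) +
        (1 - (∫⁻ y, ENNReal.ofReal (p x) * imhAcceptE (fun z => p z * w z) x y ∂q +
          ∫⁻ y, ENNReal.ofReal (1 - p x) * imhAcceptE (fun z => (1 - p z) * w z) x y ∂(R x))) * B.indicator 1 x) :
    Kernel.IsReversible K (q.withDensity fun x => ENNReal.ofReal (w x)) := by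
  intro A B hA hB
  have hw₂ : Measurable fun z => (1 - p z) * w z := (measurable_const.sub hp).mul hw
  have h2 := revProposal_flux_symm (w := fun z => (1 - p z) * w z) hw₂ R hR hA hB
  simp only at h2
  rw [choice_setLIntegral hw hp hw0 hp0 hp1 R K hK hA hB, choice_setLIntegral hw hp hw0 hp0 hp1 R K hK hB hA, Set.inter_comm,
    choice_globalFlux_symm hw hp, h2]

/-- **… INVARIANCE**: `π = w·q` is invariant. [ours] -/
theorem stateDependentChoice_invariant (hw : Measurable w) (hp : Measurable p) (hw0 : ∀ x, 0 < w x) (hp0 : ∀ x, 0 < p x)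
    (hp1 : ∀ x, p x < 1) (R : Kernel Ω Ω) [IsMarkovKernel R] (hR : Kernel.IsReversible R q) (K : Kernel Ω Ω)
    (hK : ∀ (x : Ω) {B : Set Ω}, MeasurableSet B → K x B =
      ∫⁻ y in B, ENNReal.ofReal (p x) * imhAcceptE (fun z => p z * w z) x y ∂q +
        ∫⁻ y in B, ENNReal.ofReal (1 - p x) * imhAcceptE (fun z => (1 - p z) * w z) x y ∂(R x) +
        (1 - (∫⁻ y, ENNReal.ofReal (p x) * imhAcceptE (fun z => p z * w z) x y ∂q +
          ∫⁻ y, ENNReal.ofReal (1 - p x) * imhAcceptE (fun z => (1 - p z) * w z) x y ∂(R x))) * B.indicator 1 x) :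
    Kernel.Invariant K (q.withDensity fun x => ENNReal.ofReal (w x)) := by
  haveI : IsMarkovKernel K := ⟨fun x => ⟨choice_apply_univ hp0 hp1 R K hK x⟩⟩
  exact (stateDependentChoice_isReversible hw hp hw0 hp0 hp1 R hR K hK).invariant

end Summit.Ventures.LatticeQCDFlow.Exactness
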